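import Summits.ResolutionOfSingularities.ResolutionOfSingularities.Theorems.WeightedInvariantIota3JSigmaDominanceUpgrade
import HarnessLib

/-!
# (o70-b) PART 2g — THE COARSE TRIPLE `(r₂; r₁, r₂)` AND THE COMMON FRAME OF TWO REACHING FLAGS
# (door `HypersurfaceCentreConstruction`, stmt-ResolutionOfSingularities-19897; clause h8 ⟸ (σ-pres)₃ ⟸ (o70-a) + (o70-b) + (o70-x);
# SPEC (Δ12) rev 4 `L/res-L1-w43-plan-1/JSigmaCanon_sketch.lean` d065476ee61016ce (l.223 / l.262) of res-L1-w43-plan-1; hand res-D-brk-1)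

Topic: `Summits/ResolutionOfSingularities/ResolutionOfSingularities/Theorems`. Helper for the door item
`HypersurfaceCentreConstruction` (stmt-ResolutionOfSingularities-19897, route `WeightedInvariant`), line `local-engine`
(L W4.3), def-free.  Roadmap items «PART 1♯» and (R3) of `D/res-D-brk-1/O70B-JCAN-PLAN.md` §5, for two two-flags REACHING the same
triple `(q; r₁, r₂)` (no maximality anywhere):

* `flagContactFiltration_mono_weight` — raising the transversal weight `q ↦ q'` (`q ≤ q'`) only enlarges every level: in particular both
  flags also reach the COARSE one-member triple `(r₂; r₁, r₂)`;
* `mem_span_sup_pow_of_reaches_coarse` — hence, by PART 1 (p564416) at that triple, `g₁' ∈ (g₁) + 𝔪^⌈r₁/r₂⌉` (regular local ring, any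
  dimension, `r₂ < r₁`): the FIRST members of two reaching flags agree to order `⌈r₁/r₂⌉ ≥ 2` up to a unit;
* `flagContactFiltration_le_span_pair_sup_pow` — `F(n) ≤ (g₁, g₂) + 𝔪^⌈n/q⌉` at every level;
* `span_triple_eq_maximalIdeal_of_mem_sq` — **common frame**: if `𝔪 = (x, g₂, g₁)`, `(g₁', g₂')` is a two-flag with `g₁' ∈ (g₁) + 𝔪²`
  and `g₂' ∈ (g₁, g₂) + 𝔪²` (the case `m ≥ 2` of the normal form PART 2d, p568580), then `𝔪 = (x, g₂', g₁')` as well (Nakayama): the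
  SAME transversal parameter `x` completes both flags — the frame in which the residue of (J-can) is computed.

[OURS · L1 W4.3 · (o70-b) PART 2g]  Replaces the role of NO printed item; NOT a statement of the manuscript
[claim: Hironaka2017, status: under-review]. AI work, weaker than expert review.  No named facts.

## References

* H. Matsumura, *Commutative Ring Theory* (1987), Thm. 2.3 (Nakayama). [Matsumura1987]
-/

noncomputable section

set_option linter.dupNamespace false -- mandated namespace `Summit.<Summit>.<Problem>` of this single-conjunct summit

open IsLocalRing Literature.AlgebraicGeometry.Resolution
open Summit.ResolutionOfSingularities.ResolutionOfSingularities.Theorems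

namespace Summit.ResolutionOfSingularities.ResolutionOfSingularities.Cruxes.HypersurfaceCentreConstruction.LocalEngine

namespace Iota3

universe u

section LocalRing

variable {S : Type u} [CommRing S] [IsLocalRing S]

/-- **Raising the transversal weight enlarges the filtration**: for `0 < q ≤ q'`, `F^{(q;r₁,r₂)}(n) ≤ F^{(q';r₁,r₂)}(n)` (each piece keeps
its monomial part and its `𝔪`-exponent `⌈A/q⌉` drops to `⌈A/q'⌉`). [folklore] -/
theorem flagContactFiltration_mono_weight (g₁ g₂ : S) {q q' : ℕ} (hq : 0 < q) (hqq : q ≤ q') (r₁ r₂ n : ℕ) :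
    flagContactFiltration g₁ g₂ q r₁ r₂ n ≤ flagContactFiltration g₁ g₂ q' r₁ r₂ n := by
  rw [flagContactFiltration_def g₁ g₂ q]
  refine iSup_le fun α => iSup_le fun β => (Ideal.mul_mono_right (Ideal.pow_le_pow_right ?_)).trans
    (flagPiece_le g₁ g₂ q' r₁ r₂ n α β)
  refine AQSHeightTwo.cdiv_le_of_le_mul (lt_of_lt_of_le hq hqq) ?_
  calc n - r₁ * α - r₂ * β ≤ q * ((n - r₁ * α - r₂ * β + q - 1) / q) := by
        simpa using le_add_mul_cdiv hq (n - r₁ * α - r₂ * β) 0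
    _ ≤ q' * ((n - r₁ * α - r₂ * β + q - 1) / q) := Nat.mul_le_mul_right _ hqq

/-- `F(n) ≤ (g₁, g₂) + 𝔪^⌈n/q⌉` at every level `n`. [folklore] -/
theorem flagContactFiltration_le_span_pair_sup_pow (g₁ g₂ : S) (q r₁ r₂ n : ℕ) :
    flagContactFiltration g₁ g₂ q r₁ r₂ n ≤ (Ideal.span {g₁} ⊔ Ideal.span {g₂}) ⊔ maximalIdeal S ^ ((n + q - 1) / q) := by
  rw [flagContactFiltration_def]
  refine iSup_le fun α => iSup_le fun β => ?_
  rcases Nat.eq_zero_or_pos α with hα | hα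
  · subst hα
    rcases Nat.eq_zero_or_pos β with hβ | hβ
    · subst hβ
      rw [pow_zero, pow_zero, one_mul, Ideal.span_singleton_one, Ideal.top_mul, Nat.mul_zero, Nat.mul_zero, Nat.sub_zero,
        Nat.sub_zero]
      exact le_sup_right
    · refine le_sup_of_le_left (le_sup_of_le_right ((Ideal.mul_le_right).trans ?_))
      rw [pow_zero, one_mul, Ideal.span_singleton_le_span_singleton]
      exact dvd_pow_self g₂ hβ.ne'
  · refine le_sup_of_le_left (le_sup_of_le_left ((Ideal.mul_le_right).trans ?_))
    rw [Ideal.span_singleton_le_span_singleton]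
    exact (dvd_pow_self g₁ hα.ne').mul_right _

/-- **Common frame by Nakayama.**  If `𝔪 = (x, g₂, g₁)` (Noetherian local ring), `(g₁', g₂')` is a two-flag, `g₁' ∈ (g₁) + 𝔪²` and
`g₂' ∈ (g₁, g₂) + 𝔪²`, then `𝔪 = (x, g₂', g₁')`. [cite: Matsumura1987, Thm. 2.3] -/
theorem span_triple_eq_maximalIdeal_of_mem_sq [IsNoetherianRing S] {x g₁ g₂ g₁' g₂' : S}
    (h𝔪 : Ideal.span {x, g₂, g₁} = maximalIdeal S) (hΦ' : IsTwoFlag g₁' g₂')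
    (h₁ : g₁' ∈ Ideal.span {g₁} ⊔ maximalIdeal S ^ 2) (h₂ : g₂' ∈ (Ideal.span {g₁} ⊔ Ideal.span {g₂}) ⊔ maximalIdeal S ^ 2) :
    Ideal.span {x, g₂', g₁'} = maximalIdeal S := by
  set J : Ideal S := Ideal.span {x, g₂', g₁'} with hJ
  have hx : x ∈ maximalIdeal S := h𝔪 ▸ Ideal.subset_span (by simp)
  have hg₂ : g₂ ∈ maximalIdeal S := h𝔪 ▸ Ideal.subset_span (by simp)
  have hg₁ : g₁ ∈ maximalIdeal S := h𝔪 ▸ Ideal.subset_span (by simp)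
  have hJle : J ≤ maximalIdeal S := by
    rw [hJ, Ideal.span_le]
    rintro t ht
    rcases ht with rfl | rfl | rfl
    · exact hx
    · exact hΦ'.2.1
    · exact hΦ'.1
  have hxJ : x ∈ J := Ideal.subset_span (by simp)
  have hg₂'J : g₂' ∈ J := Ideal.subset_span (by simp)
  have hg₁'J : g₁' ∈ J := Ideal.subset_span (by simp)
  -- `g₁' = u g₁ + n`, `u` a unit
  obtain ⟨ug, hug, n, hn, hsum₁⟩ := Submodule.mem_sup.mp h₁
  obtain ⟨u, rfl⟩ := Ideal.mem_span_singleton'.mp hug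
  have hu : IsUnit u := by
    by_contra hcu
    refine hΦ'.left_not_mem_sq ?_
    rw [← hsum₁, pow_two]
    exact Ideal.add_mem _ (Ideal.mul_mem_mul ((IsLocalRing.mem_maximalIdeal u).mpr hcu) hg₁) ((pow_two (maximalIdeal S)) ▸ hn)
  obtain ⟨uu, rfl⟩ := hu
  have hg₁J : g₁ ∈ J ⊔ maximalIdeal S ^ 2 := by
    have : g₁ = ↑uu⁻¹ * (↑uu * g₁ + n) - ↑uu⁻¹ * n := by
      rw [mul_add, ← mul_assoc, Units.inv_mul, one_mul, add_sub_cancel_right]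
    rw [this, hsum₁]
    exact Ideal.sub_mem _ (Ideal.mem_sup_left (Ideal.mul_mem_left _ _ hg₁'J)) (Ideal.mem_sup_right (Ideal.mul_mem_left _ _ hn))
  -- `g₂' = a g₁ + b g₂ + m₂`, `b` a unit
  obtain ⟨ab, hab, m₂, hm₂, hsum₂⟩ := Submodule.mem_sup.mp h₂
  obtain ⟨ag, hag, bg, hbg, hab'⟩ := Submodule.mem_sup.mp hab
  obtain ⟨a, rfl⟩ := Ideal.mem_span_singleton'.mp hag
  obtain ⟨b, rfl⟩ := Ideal.mem_span_singleton'.mp hbg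
  have hb : IsUnit b := by
    by_contra hbu
    have hbm : b ∈ maximalIdeal S := (IsLocalRing.mem_maximalIdeal b).mpr hbu
    -- `g₂' − a u⁻¹ g₁' ∈ 𝔪²`, contradicting the two-flag property of `(g₁', g₂')`
    have key : (-(a * ↑uu⁻¹)) * (↑uu * g₁ + n) + 1 * g₂' ∈ maximalIdeal S ^ 2 := by
      have : (-(a * ↑uu⁻¹)) * (↑uu * g₁ + n) + 1 * g₂' = b * g₂ + m₂ - a * ↑uu⁻¹ * n := by
        rw [← hsum₂, ← hab']
        have h1 : (uu⁻¹ : Sˣ).val * (uu : Sˣ).val = 1 := by simp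
        linear_combination (-(a * g₁)) * h1
      rw [this, pow_two]
      refine Ideal.sub_mem _ (Ideal.add_mem _ (Ideal.mul_mem_mul hbm hg₂) ((pow_two (maximalIdeal S)) ▸ hm₂)) ?_
      exact Ideal.mul_mem_left _ _ ((pow_two (maximalIdeal S)) ▸ hn)
    rw [hsum₁] at key
    have := (hΦ'.2.2 _ _ key).2
    exact (IsLocalRing.maximalIdeal.isMaximal S).ne_top (Ideal.eq_top_of_isUnit_mem _ this isUnit_one)
  obtain ⟨bu, rfl⟩ := hb
  have hg₂J : g₂ ∈ J ⊔ maximalIdeal S ^ 2 := by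
    have : g₂ = ↑bu⁻¹ * (a * g₁ + ↑bu * g₂ + m₂) - ↑bu⁻¹ * a * g₁ - ↑bu⁻¹ * m₂ := by
      have h1 : (bu⁻¹ : Sˣ).val * (bu : Sˣ).val = 1 := by simp
      linear_combination (-g₂) * h1
    rw [this, hab', hsum₂]
    refine Ideal.sub_mem _ (Ideal.sub_mem _ (Ideal.mem_sup_left (Ideal.mul_mem_left _ _ hg₂'J)) ?_)
      (Ideal.mem_sup_right (Ideal.mul_mem_left _ _ hm₂))
    rw [mul_assoc]
    exact Ideal.mul_mem_left _ _ (Ideal.mul_mem_left _ _ hg₁J)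
  -- Nakayama
  have hle : maximalIdeal S ≤ J ⊔ maximalIdeal S • maximalIdeal S := by
    rw [Ideal.smul_eq_mul, ← pow_two, ← h𝔪, Ideal.span_le]
    rintro t ht
    rcases ht with rfl | rfl | rfl
    · exact Ideal.mem_sup_left hxJ
    · exact h𝔪 ▸ hg₂J
    · exact h𝔪 ▸ hg₁J
  refine le_antisymm hJle ?_
  exact Submodule.le_of_le_smul_of_le_jacobson_bot (IsNoetherian.noetherian _) (IsLocalRing.maximalIdeal_le_jacobson _) hle

end LocalRing

/-! ## The coarse triple in a regular local ring -/

section Regular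

variable {S : Type u} [CommRing S] [IsRegularLocalRing S]

/-- **First members of two reaching flags agree to order `⌈r₁/r₂⌉`** (regular local ring, any dimension, `0 < q ≤ r₂ < r₁`): if
`f ∉ 𝔪^{ν+1}` (`0 < ν`) lies in level `r₁ν` of the `(q; r₁, r₂)`-filtrations of a two-flag `(g₁, g₂)` and of `g₁', g₂' ∈ 𝔪`, then
`g₁' ∈ (g₁) + 𝔪^⌈r₁/r₂⌉` — PART 1 (`mem_span_sup_pow_of_reaches`, p564416) at the coarse triple `(r₂; r₁, r₂)`, reached by both flags
by `flagContactFiltration_mono_weight`. [OURS · L1 W4.3 · (o70-b)] -/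
theorem mem_span_sup_pow_of_reaches_coarse {f g₁ g₂ g₁' g₂' : S} {q r₁ r₂ ν : ℕ} (hq : 0 < q) (hq₂ : q ≤ r₂) (hr : r₂ < r₁)
    (hν : 0 < ν) (hf : f ∉ maximalIdeal S ^ (ν + 1)) (hΦ : IsTwoFlag g₁ g₂) (hg₁' : g₁' ∈ maximalIdeal S)
    (hg₂' : g₂' ∈ maximalIdeal S) (hF : f ∈ flagContactFiltration g₁ g₂ q r₁ r₂ (r₁ * ν))
    (hF' : f ∈ flagContactFiltration g₁' g₂' q r₁ r₂ (r₁ * ν)) :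
    g₁' ∈ Ideal.span {g₁} ⊔ maximalIdeal S ^ ((r₁ + r₂ - 1) / r₂) := by
  have hr₂ : 0 < r₂ := lt_of_lt_of_le hq hq₂
  exact mem_span_sup_pow_of_reaches hr₂ hr hν hf hΦ.1 hΦ.left_not_mem_sq hΦ.2.1 hg₁' hg₂'
    (flagContactFiltration_mono_weight g₁ g₂ hq hq₂ r₁ r₂ _ hF)
    (flagContactFiltration_mono_weight g₁' g₂' hq hq₂ r₁ r₂ _ hF')

/-- In particular `g₁' ∈ (g₁) + 𝔪²` (`⌈r₁/r₂⌉ ≥ 2` for `r₂ < r₁`). [OURS · L1 W4.3 · (o70-b)] -/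
theorem mem_span_sup_sq_of_reaches {f g₁ g₂ g₁' g₂' : S} {q r₁ r₂ ν : ℕ} (hq : 0 < q) (hq₂ : q ≤ r₂) (hr : r₂ < r₁)
    (hν : 0 < ν) (hf : f ∉ maximalIdeal S ^ (ν + 1)) (hΦ : IsTwoFlag g₁ g₂) (hg₁' : g₁' ∈ maximalIdeal S)
    (hg₂' : g₂' ∈ maximalIdeal S) (hF : f ∈ flagContactFiltration g₁ g₂ q r₁ r₂ (r₁ * ν))
    (hF' : f ∈ flagContactFiltration g₁' g₂' q r₁ r₂ (r₁ * ν)) :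
    g₁' ∈ Ideal.span {g₁} ⊔ maximalIdeal S ^ 2 := by
  have hr₂ : 0 < r₂ := lt_of_lt_of_le hq hq₂
  have hc : 2 ≤ (r₁ + r₂ - 1) / r₂ := by rw [Nat.le_div_iff_mul_le hr₂]; omega
  have hle : Ideal.span {g₁} ⊔ maximalIdeal S ^ ((r₁ + r₂ - 1) / r₂) ≤ Ideal.span {g₁} ⊔ maximalIdeal S ^ 2 :=
    sup_le_sup_left (Ideal.pow_le_pow_right hc) _
  exact hle (mem_span_sup_pow_of_reaches_coarse hq hq₂ hr hν hf hΦ hg₁' hg₂' hF hF')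

/-- **Common frame for a non-dominant second member of order `m ≥ 2`** (regular local ring with `𝔪 = (x, g₂, g₁)`, two two-flags
reaching `(q; r₁, r₂)`, `0 < q ≤ r₂ < r₁`, `f ∉ 𝔪^{ν+1}`): if `g₂' = s·x^m + t` with `2 ≤ m` and `t ∈ F_{(g₁,g₂)}(qm + 1)` (PART 2d's
normal form), then `𝔪 = (x, g₂', g₁')`. [OURS · L1 W4.3 · (o70-b)] -/
theorem span_triple_eq_maximalIdeal_of_normalForm {x f g₁ g₂ g₁' g₂' s t : S} {q r₁ r₂ ν m : ℕ}
    (h𝔪 : Ideal.span {x, g₂, g₁} = maximalIdeal S) (hq : 0 < q) (hq₂ : q ≤ r₂) (hr : r₂ < r₁) (hν : 0 < ν)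
    (hf : f ∉ maximalIdeal S ^ (ν + 1)) (hΦ : IsTwoFlag g₁ g₂) (hΦ' : IsTwoFlag g₁' g₂')
    (hF : f ∈ flagContactFiltration g₁ g₂ q r₁ r₂ (r₁ * ν)) (hF' : f ∈ flagContactFiltration g₁' g₂' q r₁ r₂ (r₁ * ν))
    (hm : 2 ≤ m) (hg₂' : g₂' = s * x ^ m + t) (ht : t ∈ flagContactFiltration g₁ g₂ q r₁ r₂ (q * m + 1)) :
    Ideal.span {x, g₂', g₁'} = maximalIdeal S := by
  have hx : x ∈ maximalIdeal S := h𝔪 ▸ Ideal.subset_span (by simp)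
  refine span_triple_eq_maximalIdeal_of_mem_sq h𝔪 hΦ'
    (mem_span_sup_sq_of_reaches hq hq₂ hr hν hf hΦ hΦ'.1 hΦ'.2.1 hF hF') ?_
  rw [hg₂']
  refine Ideal.add_mem _ (Ideal.mem_sup_right ?_) ?_
  · rw [pow_two]
    have hxm : x ^ m ∈ maximalIdeal S * maximalIdeal S := by
      have := Ideal.pow_mem_pow hx m
      exact (pow_two (maximalIdeal S)) ▸ Ideal.pow_le_pow_right hm this
    exact Ideal.mul_mem_left _ s hxm
  · have hmem := flagContactFiltration_le_span_pair_sup_pow g₁ g₂ q r₁ r₂ (q * m + 1) ht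
    have h2 : 2 ≤ (q * m + 1 + q - 1) / q := by
      rw [Nat.le_div_iff_mul_le hq]
      have : 2 * q ≤ q * m := by rw [mul_comm]; exact Nat.mul_le_mul_left q hm
      omega
    have hle : (Ideal.span {g₁} ⊔ Ideal.span {g₂}) ⊔ maximalIdeal S ^ ((q * m + 1 + q - 1) / q) ≤
        (Ideal.span {g₁} ⊔ Ideal.span {g₂}) ⊔ maximalIdeal S ^ 2 := sup_le_sup_left (Ideal.pow_le_pow_right h2) _
    exact hle hmem

end Regular

end Iota3

end Summit.ResolutionOfSingularities.ResolutionOfSingularities.Cruxes.HypersurfaceCentreConstruction.LocalEngine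

end
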